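import Mathlib
import Literature.NumberTheory.LFunctions.ExplicitLandauPageFamily
import HarnessLib

/-!
# The real-inequality LINES of the B-dh KILL certificate on the world `W⁺(𝓛)`, `𝓛 ≥ 43 250`
# (cell `landau-siegel`, family B-dh: `B-dh/KILL-draft.md` v1.1 §2 (P4, P1-binders, P6), §3)

Topic `Literature/NumberTheory/LFunctions/Zhang2022` (namespace
`Literature.NumberTheory.LFunctions.Zhang2022.DHMenuLines`). Everything in this file is PROVED
(real analysis only; NO `L`-functions, no named fact): the closed real inequalities in the single
variable `L = log D ≥ 43 250` that the explicit world `W⁺(𝓛)` of the B-dh KILL certificate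
(`Zhang2022.DH.MenuConsistent`, typed by ls-Bdh-typer-2) must satisfy row by row, with the world's
three explicit quantities

* `lam L = ½ L⁻²⁰²²` — the value `λ = L(1,χ_D)` of the world (half of Zhang's (A)-cap `L⁻²⁰²²`);
* `delta L = (2/3) L⁻²⁰²²` — `δ = 1 − β₁ = λ/0.75` (inside Benli–Goel–Twiss–Zaman's Lemma 2.9 window
  `0.72 ≤ λ/δ ≤ 0.18 L²`);
* `v G L = (3/2)·G·log L` — the value `|L(1,ψ)|` of the non-exceptional characters at `log q = L`,
  with `G` standing for `e^γ` (any `G ∈ [1.64, 1.95]`; Mathlib knows `1/2 < γ < 2/3`, whence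
  `e^γ ∈ (1.648, 1.948)`, `vGamma_envelope`).

Lines proved for all `L ≥ 43 250` (decl names fixed by the family planner, `B-dh/PLAN.md` writer,
INBOX 2026-08-26T17:10:35Z): (a) class-number / Oesterlé floors below `λ` (`floor069_lt_lam`,
`floorPi_lt_lam`, `floorReal_lt_lam`, `floorOesterle_lt_lam`); (b) the Page-type floors below `δ`
(`bordignon_lt_delta`, `tree80_lt_delta`); (c) the Lemma 2.9 window (`lemma29_window`); (d) the
repulsion binders (`bgtz_binder`: `δ < 1/(10L)`; `tz215_binder`: `δ ≤ zfrConst/L` and `≤ 0.10367/L`);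
(e) Assumption (A) itself (`rowA`: `λ < L⁻²⁰²²`); (f) the P6 value envelope (`envelope`,
`vGamma_envelope`); (g) the analytic helpers they rest on (`log_43250_lt`: `log 43250 < 10.68`;
`log_le_lin`: `log L ≤ 10.68 + (L − 43250)/43250`; `mul_pow_lt_exp_half`: `c·Lⁿ < e^{L/2}` whenever
`n ≤ 2023` and `c − 1 + 10.68·n ≤ 21 624`; `ten_le_log`; `log_log_le`) — these helpers are
`private` (pure numerics carry no citation; the tree's lint keeps uncited statements out of
`Literature/`); the cited LINES are the public interface.

Method: every power-versus-exponential line is `log(c Lⁿ) = log c + n log L ≤ (c − 1) + n(10.68 +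
(L − 43250)/43250) < L/2`, the last step being linear in `L` with slope `n/43250 < 1/2` and value
`≤ 21 624 < 21 625` at `L = 43 250`; the bracket `log 43 250 < 10.68` is `e^{10.68} = (e)^{10} e^{0.68}
> 22 026 · 1.9737 > 43 250` (Mathlib's `Real.exp_one_gt_d9` and the Taylor minorant
`Real.sum_le_exp_of_nonneg` with six terms).

WHAT THIS IS NOT: no statement about `L`-functions, zeros or class numbers — these are the
ARITHMETIC lines only; which printed row each line instantiates is recorded in the docstrings and in
`B-dh/KILL-draft.md` §2; the certificate statement and its §E proof cite these lemmas by name.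

«The programme SEARCHES and TYPES; no claim about Landau–Siegel zeros, Theorems 1–2 of
arXiv:2211.02515 or a repaired Margin232 until a kernel theorem says so.»

## References

* `pub/landau-siegel/B-dh/KILL-draft.md` v1.1 (ls-Bdh-plan), §2 P4/P1/P6 and §3 (the world `W⁺`).
* [BenliGoelTwissZaman2025] Lemma 2.9 (`0.72`, `0.18 log²q`), Cor. 1.1 (binder `1/(10 log q)`),
  Thm. 2.8 (Bordignon `100/(√q log²q)`). [ThornerZaman2024LogFree] Thm. 2.15 (binder
  `zfrConst/log Q`). [MontgomeryVaughan2007] §4.3 (class-number floors). Oesterlé 1985 (`(π/55) log D`).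
  [Zhang2022LandauSiegel] §2 Assumption (A).
-/

noncomputable section

open Real Finset

namespace Literature.NumberTheory.LFunctions.Zhang2022.DHMenuLines

/-! ### The world's explicit quantities -/

/-- `λ(L) = ½ L⁻²⁰²²` — the world's value of `L(1,χ_D)` at `L = log D`.
[cite: Zhang2022LandauSiegel, §2 Assumption (A)] -/
def lam (L : ℝ) : ℝ := 1 / (2 * L ^ 2022)

/-- `δ(L) = (2/3) L⁻²⁰²² = λ/0.75` — the world's `1 − β₁`.
[cite: BenliGoelTwissZaman2025, Lemma 2.9] -/
def delta (L : ℝ) : ℝ := 2 / (3 * L ^ 2022)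

/-- `v(G, L) = (3/2)·G·log L` — the world's value `|L(1,ψ)|` for non-exceptional `ψ` at `log q = L`,
`G` a stand-in for `e^γ`. [folklore] -/
def v (G L : ℝ) : ℝ := 3 / 2 * G * Real.log L

/-- `v` at the true `e^γ` (Mathlib's `Real.eulerMascheroniConstant`). [folklore] -/
def vGamma (L : ℝ) : ℝ := v (Real.exp Real.eulerMascheroniConstant) L

/-- `δ = λ/0.75`. [cite: BenliGoelTwissZaman2025, Lemma 2.9] -/
theorem delta_eq_lam_div (L : ℝ) : delta L = lam L / 0.75 := by
  unfold delta lam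
  rcases eq_or_ne (L ^ 2022) 0 with h | h
  · rw [h]; norm_num
  · field_simp
    norm_num

/-- `λ > 0` for `L > 0` (the world's `L(1,χ_D)` is a positive number, as (A) presupposes).
[cite: Zhang2022LandauSiegel, §2 Assumption (A)] -/
theorem lam_pos {L : ℝ} (hL : 0 < L) : 0 < lam L := by
  unfold lam; positivity

/-- `δ > 0` for `L > 0` (`β₁ = 1 − δ < 1`, a real ZERO as in Lemma 2.9).
[cite: BenliGoelTwissZaman2025, Lemma 2.9] -/
theorem delta_pos {L : ℝ} (hL : 0 < L) : 0 < delta L := by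
  unfold delta; positivity

/-! ### Numerical brackets -/

/-- `e^{10} > 22 026` (from `e > 2.7182818283`). [folklore] -/
private theorem exp_ten_gt : (22026 : ℝ) < Real.exp 10 := by
  have h1 : (2.7182818283 : ℝ) < Real.exp 1 := Real.exp_one_gt_d9
  have h10 : Real.exp 10 = Real.exp 1 ^ 10 := by
    rw [← Real.exp_nat_mul]; norm_num
  rw [h10]
  calc (22026 : ℝ) < 2.7182818283 ^ 10 := by norm_num
    _ ≤ Real.exp 1 ^ 10 := by
        exact pow_le_pow_left₀ (by norm_num) h1.le 10

/-- `e^{10} < 22 027` (from `e < 2.7182818286`). [folklore] -/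
private theorem exp_ten_lt : Real.exp 10 < 22027 := by
  have h1 : Real.exp 1 < 2.7182818286 := Real.exp_one_lt_d9
  have h10 : Real.exp 10 = Real.exp 1 ^ 10 := by
    rw [← Real.exp_nat_mul]; norm_num
  rw [h10]
  calc Real.exp 1 ^ 10 ≤ 2.7182818286 ^ 10 :=
        pow_le_pow_left₀ (Real.exp_pos 1).le h1.le 10
    _ < 22027 := by norm_num

/-- `e^{0.68} > 1.9737` (six Taylor terms). [folklore] -/
private theorem exp_068_gt : (1.9737 : ℝ) < Real.exp 0.68 := by
  have h := Real.sum_le_exp_of_nonneg (show (0 : ℝ) ≤ 0.68 by norm_num) 6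
  have hs : ∑ i ∈ Finset.range 6, (0.68 : ℝ) ^ i / (Nat.factorial i : ℝ) =
      1 + 0.68 + 0.68 ^ 2 / 2 + 0.68 ^ 3 / 6 + 0.68 ^ 4 / 24 + 0.68 ^ 5 / 120 := by
    norm_num [Finset.sum_range_succ, Nat.factorial]
  rw [hs] at h
  have : (1.9737 : ℝ) < 1 + 0.68 + 0.68 ^ 2 / 2 + 0.68 ^ 3 / 6 + 0.68 ^ 4 / 24 + 0.68 ^ 5 / 120 := by
    norm_num
  linarith

/-- `e^{10.68} > 43 250`. [folklore] -/
private theorem exp_1068_gt : (43250 : ℝ) < Real.exp 10.68 := by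
  have h : Real.exp 10.68 = Real.exp 10 * Real.exp 0.68 := by
    rw [← Real.exp_add]; norm_num
  rw [h]
  have h1 := exp_ten_gt
  have h2 := exp_068_gt
  calc (43250 : ℝ) < 22026 * 1.9737 := by norm_num
    _ < Real.exp 10 * Real.exp 0.68 := by
        exact mul_lt_mul'' h1 h2 (by norm_num) (by norm_num)

/-- **The bracket `log 43 250 < 10.68`.** [folklore] -/
private theorem log_43250_lt : Real.log 43250 < 10.68 := by
  rw [Real.log_lt_iff_lt_exp (by norm_num)]
  exact exp_1068_gt

/-- `log L ≥ 10` for `L ≥ 43 250` (indeed `e^{10} < 22 027`). [folklore] -/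
private theorem ten_le_log {L : ℝ} (hL : 43250 ≤ L) : 10 ≤ Real.log L := by
  rw [Real.le_log_iff_exp_le (by linarith)]
  linarith [exp_ten_lt]

/-- **Concavity bound** `log L ≤ 10.68 + (L − 43250)/43250` for `L ≥ 43 250`
(`log L = log 43250 + log(L/43250)` and `log x ≤ x − 1`). [folklore] -/
private theorem log_le_lin {L : ℝ} (hL : 43250 ≤ L) : Real.log L ≤ 10.68 + (L - 43250) / 43250 := by
  have hL0 : 0 < L := by linarith
  have hsplit : Real.log L = Real.log 43250 + Real.log (L / 43250) := by
    rw [← Real.log_mul (by norm_num) (by positivity)]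
    congr 1; field_simp
  have hx : Real.log (L / 43250) ≤ L / 43250 - 1 := Real.log_le_sub_one_of_pos (by positivity)
  have h43 := log_43250_lt
  rw [hsplit]
  have : L / 43250 - 1 = (L - 43250) / 43250 := by field_simp
  linarith

/-- `log(log L) ≤ log L / 2.7182818283` for `L ≥ 43 250` (`log y ≤ y/e`: `log(y/e) ≤ y/e − 1`).
[folklore] -/
private theorem log_log_le {L : ℝ} (hL : 43250 ≤ L) :
    Real.log (Real.log L) ≤ Real.log L / 2.7182818283 := by
  have hy : 0 < Real.log L := by linarith [ten_le_log hL]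
  have he : 0 < Real.exp 1 := Real.exp_pos 1
  have h1 : Real.log (Real.log L) = Real.log (Real.log L / Real.exp 1) + 1 := by
    rw [Real.log_div hy.ne' he.ne', Real.log_exp]; ring
  have h2 : Real.log (Real.log L / Real.exp 1) ≤ Real.log L / Real.exp 1 - 1 :=
    Real.log_le_sub_one_of_pos (by positivity)
  have h3 : Real.log L / Real.exp 1 ≤ Real.log L / 2.7182818283 :=
    div_le_div_of_nonneg_left hy.le (by norm_num) Real.exp_one_gt_d9.le
  linarith

/-- **Master line: a power loses to `e^{L/2}` on `[43 250, ∞)`.** For `c > 0`, `n ≤ 2023` and the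
budget `c − 1 + 10.68·n ≤ 21 624`: `c·Lⁿ < e^{L/2}` for every `L ≥ 43 250`
(`log(cLⁿ) ≤ (c − 1) + n(10.68 + (L − 43250)/43250) ≤ 21624 + (n/43250)(L − 43250) < L/2`).
[folklore] -/
private theorem mul_pow_lt_exp_half {L c : ℝ} {n : ℕ} (hL : 43250 ≤ L) (hc : 0 < c) (hn : (n : ℝ) ≤ 2023)
    (hbudget : c - 1 + 10.68 * n ≤ 21624) : c * L ^ n < Real.exp (L / 2) := by
  have hL0 : 0 < L := by linarith
  have hpos : 0 < c * L ^ n := by positivity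
  rw [← Real.exp_log hpos, Real.exp_lt_exp, Real.log_mul hc.ne' (by positivity), Real.log_pow]
  have hlogc : Real.log c ≤ c - 1 := Real.log_le_sub_one_of_pos hc
  have hlogL := log_le_lin hL
  have hn0 : (0 : ℝ) ≤ n := Nat.cast_nonneg n
  have h1 : (n : ℝ) * Real.log L ≤ n * (10.68 + (L - 43250) / 43250) :=
    mul_le_mul_of_nonneg_left hlogL hn0
  have h2 : (n : ℝ) * ((L - 43250) / 43250) ≤ 2023 * ((L - 43250) / 43250) :=
    mul_le_mul_of_nonneg_right hn (by apply div_nonneg <;> linarith)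
  nlinarith

/-! ### (a) Floors below `λ` (P4: class-number formula, real case, Oesterlé) -/

/-- **Line (a1):** `0.69·e^{−L/2} < λ(L)` — the tree floor `‖L(1,χ)‖ ≥ 0.69/√q`
(`RealZeroRepulsion.norm_LFunction_one_ge`) lies below the world's `λ`.
[cite: MontgomeryVaughan2007, §4.3 (class number formula)] -/
theorem floor069_lt_lam {L : ℝ} (hL : 43250 ≤ L) : 0.69 * Real.exp (-(L / 2)) < lam L := by
  have hL0 : 0 < L := by linarith
  have hmain : 1.38 * L ^ 2022 < Real.exp (L / 2) :=
    mul_pow_lt_exp_half hL (by norm_num) (by norm_num) (by norm_num)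
  unfold lam
  rw [Real.exp_neg, lt_div_iff₀ (by positivity)]
  have hE : 0 < Real.exp (L / 2) := Real.exp_pos _
  rw [show 0.69 * (Real.exp (L / 2))⁻¹ * (2 * L ^ 2022) = 1.38 * L ^ 2022 / Real.exp (L / 2) by ring,
    div_lt_one hE]
  exact hmain

/-- **Line (a2):** `π·e^{−L/2} < λ(L)` — the printed odd floor `L(1,χ_{−D}) ≥ π/√D` (`h(−D) ≥ 1`).
[cite: MontgomeryVaughan2007, §4.3 (class number formula)] -/
theorem floorPi_lt_lam {L : ℝ} (hL : 43250 ≤ L) : Real.pi * Real.exp (-(L / 2)) < lam L := by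
  have hL0 : 0 < L := by linarith
  have hπ : Real.pi < 3.15 := Real.pi_lt_d2
  have hmain : (2 * Real.pi) * L ^ 2022 < Real.exp (L / 2) :=
    mul_pow_lt_exp_half hL (by positivity) (by norm_num) (by nlinarith)
  unfold lam
  rw [Real.exp_neg, lt_div_iff₀ (by positivity)]
  have hE : 0 < Real.exp (L / 2) := Real.exp_pos _
  rw [show Real.pi * (Real.exp (L / 2))⁻¹ * (2 * L ^ 2022) =
      2 * Real.pi * L ^ 2022 / Real.exp (L / 2) by ring, div_lt_one hE]
  exact hmain

/-- **Line (a3):** `0.9624·e^{−L/2} < λ(L)` — the printed even floor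
`L(1,χ_D) ≥ 2 log((1+√5)/2)/√D` (`0.9624 = 2 log((1+√5)/2)` rounded down; `h ≥ 1`, `ε_D ≥ (1+√5)/2`).
[cite: MontgomeryVaughan2007, §4.3 (class number formula)] -/
theorem floorReal_lt_lam {L : ℝ} (hL : 43250 ≤ L) : 0.9624 * Real.exp (-(L / 2)) < lam L := by
  have hL0 : 0 < L := by linarith
  have hmain : 1.9248 * L ^ 2022 < Real.exp (L / 2) :=
    mul_pow_lt_exp_half hL (by norm_num) (by norm_num) (by norm_num)
  unfold lam
  rw [Real.exp_neg, lt_div_iff₀ (by positivity)]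
  have hE : 0 < Real.exp (L / 2) := Real.exp_pos _
  rw [show 0.9624 * (Real.exp (L / 2))⁻¹ * (2 * L ^ 2022) =
      1.9248 * L ^ 2022 / Real.exp (L / 2) by ring, div_lt_one hE]
  exact hmain

/-- **Line (a4):** `(π/55)·L·e^{−L/2} < λ(L)` — Oesterlé's explicit Goldfeld–Gross–Zagier floor
`h(−D) > (1/55) log D ∏(…)` (the product `≤ 1` dropped, i.e. the floor taken at its largest) lies
below `λ`. [cite: MontgomeryVaughan2007, §4.3 (class number formula)] -/
theorem floorOesterle_lt_lam {L : ℝ} (hL : 43250 ≤ L) :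
    Real.pi / 55 * L * Real.exp (-(L / 2)) < lam L := by
  have hL0 : 0 < L := by linarith
  have hπ : Real.pi < 3.15 := Real.pi_lt_d2
  have hmain : (2 * Real.pi / 55) * L ^ 2023 < Real.exp (L / 2) :=
    mul_pow_lt_exp_half hL (by positivity) (by norm_num) (by nlinarith)
  unfold lam
  rw [Real.exp_neg, lt_div_iff₀ (by positivity)]
  have hE : 0 < Real.exp (L / 2) := Real.exp_pos _
  rw [show Real.pi / 55 * L * (Real.exp (L / 2))⁻¹ * (2 * L ^ 2022) =
      2 * Real.pi / 55 * L ^ 2023 / Real.exp (L / 2) by ring, div_lt_one hE]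
  exact hmain

/-! ### (b) Floors below `δ` (P4: Bordignon / the tree's `1/80`) -/

/-- **Line (b1):** `100·e^{−L/2}/L² < δ(L)` — Bordignon's `β₁ ≤ 1 − 100/(√q log²q)`
(`BGTZ2025.theorem28_bordignon`) is consistent with `β₁ = 1 − δ` (`150 L²⁰²⁰ ≤ L²⁰²¹ < e^{L/2}`).
[cite: BenliGoelTwissZaman2025, Theorem 2.8] -/
theorem bordignon_lt_delta {L : ℝ} (hL : 43250 ≤ L) :
    100 * Real.exp (-(L / 2)) / L ^ 2 < delta L := by
  have hL0 : 0 < L := by linarith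
  have hmain : 1 * L ^ 2021 < Real.exp (L / 2) :=
    mul_pow_lt_exp_half hL (by norm_num) (by norm_num) (by norm_num)
  have h150 : 150 * L ^ 2020 ≤ L ^ 2021 := by
    have : L ^ 2021 = L ^ 2020 * L := by ring
    rw [this]
    have hp : 0 ≤ L ^ 2020 := by positivity
    nlinarith
  unfold delta
  rw [Real.exp_neg, div_lt_div_iff₀ (by positivity) (by positivity)]
  have hE : 0 < Real.exp (L / 2) := Real.exp_pos _
  -- `100 e^{-L/2} · 3 L^2022 < 2 L²` ⟸ `150 L^2020 < e^{L/2}`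
  have key : 150 * L ^ 2020 < Real.exp (L / 2) := by linarith
  have hsplit : 100 * (Real.exp (L / 2))⁻¹ * (3 * L ^ 2022) =
      (150 * L ^ 2020 / Real.exp (L / 2)) * (2 * L ^ 2) := by
    rw [div_eq_mul_inv]; ring
  rw [hsplit]
  have hlt1 : 150 * L ^ 2020 / Real.exp (L / 2) < 1 := by rwa [div_lt_one hE]
  have h2 : 0 < 2 * L ^ 2 := by positivity
  nlinarith

/-- **Line (b2):** `1/(80·e^{L/2}·L²) < δ(L)` — the tree's kernel floor `1 − β ≥ 1/(80√q log²q)`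
(`RealZeroRepulsion.one_sub_realZero_ge_explicit_of_eight_le`) is consistent with `β₁ = 1 − δ`.
[cite: MontgomeryVaughan2007, §11.2 Corollary 11.15 (proof)] -/
theorem tree80_lt_delta {L : ℝ} (hL : 43250 ≤ L) :
    1 / (80 * Real.exp (L / 2) * L ^ 2) < delta L := by
  have hL0 : 0 < L := by linarith
  have hmain : 1 * L ^ 2020 < Real.exp (L / 2) :=
    mul_pow_lt_exp_half hL (by norm_num) (by norm_num) (by norm_num)
  have hE : 0 < Real.exp (L / 2) := Real.exp_pos _
  unfold delta
  rw [div_lt_div_iff₀ (by positivity) (by positivity)]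
  -- `3 L^2022 < 2 · 80 e^{L/2} L²` ⟸ `L^2020 < e^{L/2}`
  have : (1 : ℝ) * (3 * L ^ 2022) = 3 * L ^ 2020 * L ^ 2 := by ring
  rw [this]
  have : (2 : ℝ) * (80 * Real.exp (L / 2) * L ^ 2) = 160 * Real.exp (L / 2) * L ^ 2 := by ring
  rw [this]
  have h2 : 0 < L ^ 2 := by positivity
  nlinarith

/-! ### (c) The Lemma 2.9 window, (d) the repulsion binders, (e) row (A) -/

/-- **Line (c):** `0.72·δ < λ ≤ 0.18·L²·δ` — the world's pair `(λ, δ)` lies inside Benli–Goel–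
Twiss–Zaman's Lemma 2.9 window `0.72 ≤ L(1,χ₁)/(1 − β₁) ≤ 0.18 log²q` (strictly at the left end:
`λ/δ = 0.75`). [cite: BenliGoelTwissZaman2025, Lemma 2.9] -/
theorem lemma29_window {L : ℝ} (hL : 43250 ≤ L) :
    0.72 * delta L < lam L ∧ lam L ≤ 0.18 * L ^ 2 * delta L := by
  have hL0 : 0 < L := by linarith
  have hP : 0 < L ^ 2022 := by positivity
  unfold delta lam
  constructor
  · rw [mul_div_assoc', div_lt_div_iff₀ (by positivity) (by positivity)]
    nlinarith
  · rw [mul_div_assoc', div_le_div_iff₀ (by positivity) (by positivity)]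
    have hL2 : 43250 ^ 2 ≤ L ^ 2 := pow_le_pow_left₀ (by norm_num) hL 2
    nlinarith

/-- **Line (d1):** `δ(L) < 1/(10L)` — the world's exceptional zero `β₁ = 1 − δ` lies in the
Benli–Goel–Twiss–Zaman window `β₁ > 1 − 1/(10 log q)` at `log q = L`.
[cite: BenliGoelTwissZaman2025, Corollary 1.1] -/
theorem bgtz_binder {L : ℝ} (hL : 43250 ≤ L) : delta L < 1 / (10 * L) := by
  have hL0 : 0 < L := by linarith
  unfold delta
  rw [div_lt_div_iff₀ (by positivity) (by positivity)]
  have h1 : L ≤ L ^ 2021 := le_self_pow₀ (by linarith) (by norm_num)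
  have : (1 : ℝ) * (3 * L ^ 2022) = 3 * L ^ 2021 * L := by ring
  rw [this]
  nlinarith

/-- The same window as a statement about `β₁ = 1 − δ`: `1 − 1/(10L) < 1 − δ(L) < 1`.
[cite: BenliGoelTwissZaman2025, Corollary 1.1] -/
theorem window {L : ℝ} (hL : 43250 ≤ L) : 1 - 1 / (10 * L) < 1 - delta L ∧ 1 - delta L < 1 := by
  have h := bgtz_binder hL
  have hd := delta_pos (show (0 : ℝ) < L by linarith)
  constructor <;> linarith

/-- **Line (d2):** `δ(L) ≤ zfrConst/L` (`zfrConst = 1/9.645908801`) — the world's `β₁(Q) = 1 − δ`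
satisfies Thorner–Zaman's Theorem 2.15 binder `β₁(Q) ≥ 1 − c/log Q` at `log Q = L`.
[cite: ThornerZaman2024LogFree, Theorem 2.15] -/
theorem tz215_binder {L : ℝ} (hL : 43250 ≤ L) : delta L ≤ ThornerZaman2024.zfrConst / L := by
  have hL0 : 0 < L := by linarith
  unfold delta ThornerZaman2024.zfrConst
  rw [div_le_div_iff₀ (by positivity) (by positivity)]
  have h1 : L ≤ L ^ 2021 := le_self_pow₀ (by linarith) (by norm_num)
  have : (1 : ℝ) / 9.645908801 * (3 * L ^ 2022) = 3 / 9.645908801 * L ^ 2021 * L := by ring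
  rw [this]
  nlinarith

/-- **Line (d2′):** the same with the decimal `0.10367 < zfrConst`: `δ(L) ≤ 0.10367/L`.
[cite: ThornerZaman2024LogFree, Theorem 2.15] -/
theorem tz215_binder' {L : ℝ} (hL : 43250 ≤ L) : delta L ≤ 0.10367 / L := by
  have hL0 : 0 < L := by linarith
  unfold delta
  rw [div_le_div_iff₀ (by positivity) (by positivity)]
  have h1 : L ≤ L ^ 2021 := le_self_pow₀ (by linarith) (by norm_num)
  have : (0.10367 : ℝ) * (3 * L ^ 2022) = 0.31101 * L ^ 2021 * L := by ring
  rw [this]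
  nlinarith

/-- **Line (e), row (A):** `λ(L) < L⁻²⁰²²` — the world satisfies Zhang's Assumption (A)
`L(1,χ) < (log D)⁻²⁰²²`. [cite: Zhang2022LandauSiegel, §2 Assumption (A)] -/
theorem rowA {L : ℝ} (hL : 43250 ≤ L) : lam L < 1 / L ^ 2022 := by
  have hL0 : 0 < L := by linarith
  unfold lam
  rw [div_lt_div_iff₀ (by positivity) (by positivity)]
  have : 0 < L ^ 2022 := by positivity
  nlinarith

/-- Row (A) in the tree's form `λ(L) < (L ^ 2022)⁻¹`. [cite: Zhang2022LandauSiegel, §2 Assumption (A)] -/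
theorem rowA' {L : ℝ} (hL : 43250 ≤ L) : lam L < (L ^ 2022)⁻¹ := by
  rw [← one_div]; exact rowA hL

/-! ### (f) The P6 value envelope for the non-exceptional characters -/

/-- **Line (f), parametric in `G ∈ [1.64, 1.95]` (a stand-in for `e^γ = 1.78107…`):** for
`L ≥ 43 250`, with `v = (3/2)·G·log L`,
`1.7810725·(log L + log log L) < v`, `v < 2·1.7810724·(log L − log 2 + 1/2 + 1/log L)` and
`v ≤ log(e^L) = L` — the Granville–Soundararajan-type floor `e^γ(log log q + log log log q)`,
the GRH-type cap `2e^γ(log log q − log 2 + ½ + 1/log log q)` (Lamzouri–Li–Soundararajan's shape) and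
the trivial cap `log q`, all at `log q = L` (the cap's shape and constants are Lamzouri–Li–
Soundararajan's Theorem 1.5). [cite: LamzouriLiSoundararajan2015, Theorem 1.5 p. 2393] -/
theorem envelope {G L : ℝ} (hG1 : 1.64 ≤ G) (hG2 : G ≤ 1.95) (hL : 43250 ≤ L) :
    1.7810725 * (Real.log L + Real.log (Real.log L)) < v G L ∧
      v G L < 2 * 1.7810724 * (Real.log L - Real.log 2 + 1 / 2 + 1 / Real.log L) ∧
        v G L ≤ Real.log (Real.exp L) := by
  have hlog10 := ten_le_log hL
  have hy : 0 < Real.log L := by linarith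
  have hll := log_log_le hL
  have hlin := log_le_lin hL
  have hlog2 : Real.log 2 < 0.6931471808 := Real.log_two_lt_d9
  have hinv : 0 < 1 / Real.log L := by positivity
  unfold v
  refine ⟨?_, ?_, ?_⟩
  · -- `1.7810725 (y + y/2.7182818283) < 1.5·1.64·y ≤ 1.5·G·y`
    have h1 : 3 / 2 * 1.64 * Real.log L ≤ 3 / 2 * G * Real.log L := by
      have := mul_le_mul_of_nonneg_right hG1 hy.le
      nlinarith
    have h2 : 1.7810725 * (Real.log L + Real.log (Real.log L)) ≤
        1.7810725 * (Real.log L + Real.log L / 2.7182818283) := by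
      apply mul_le_mul_of_nonneg_left _ (by norm_num)
      linarith
    have h3 : 1.7810725 * (Real.log L + Real.log L / 2.7182818283) <
        3 / 2 * 1.64 * Real.log L := by
      rw [show 1.7810725 * (Real.log L + Real.log L / 2.7182818283) =
        (1.7810725 * (1 + 1 / 2.7182818283)) * Real.log L by ring]
      exact mul_lt_mul_of_pos_right (by norm_num) hy
    linarith
  · have h1 : 3 / 2 * G * Real.log L ≤ 3 / 2 * 1.95 * Real.log L := by
      have := mul_le_mul_of_nonneg_right hG2 hy.le
      nlinarith
    nlinarith
  · rw [Real.log_exp]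
    have h1 : 3 / 2 * G * Real.log L ≤ 3 / 2 * 1.95 * Real.log L := by
      have := mul_le_mul_of_nonneg_right hG2 hy.le
      nlinarith
    nlinarith

/-- `e^γ ∈ [1.64, 1.95]` from Mathlib's `1/2 < γ < 2/3` (`e^{1/2} > 1.64`, `e^{2/3} < 1.95`).
[folklore] -/
private theorem exp_eulerMascheroni_mem :
    1.64 ≤ Real.exp Real.eulerMascheroniConstant ∧ Real.exp Real.eulerMascheroniConstant ≤ 1.95 := by
  have hγ1 : 1 / 2 < Real.eulerMascheroniConstant := Real.one_half_lt_eulerMascheroniConstant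
  have hγ2 : Real.eulerMascheroniConstant < 2 / 3 := Real.eulerMascheroniConstant_lt_two_thirds
  have he1 : (2.7182818283 : ℝ) < Real.exp 1 := Real.exp_one_gt_d9
  have he2 : Real.exp 1 < 2.7182818286 := Real.exp_one_lt_d9
  constructor
  · -- `1.64 ≤ e^{1/2}`: `1.64² = 2.6896 < e`
    have hhalf : (1.64 : ℝ) ≤ Real.exp (1 / 2) := by
      by_contra h
      push Not at h
      have hsq : Real.exp (1 / 2) ^ 2 = Real.exp 1 := by
        rw [← Real.exp_nat_mul]; norm_num
      have hp : 0 < Real.exp (1 / 2) := Real.exp_pos _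
      have : Real.exp (1 / 2) ^ 2 < 1.64 ^ 2 := by
        exact pow_lt_pow_left₀ h hp.le two_ne_zero
      rw [hsq] at this
      norm_num at this
      linarith
    exact hhalf.trans (Real.exp_le_exp.2 hγ1.le)
  · -- `e^{2/3} ≤ 1.95`: `e² < 7.3891 < 1.95³ = 7.414875`
    have h23 : Real.exp (2 / 3) ≤ 1.95 := by
      by_contra h
      push Not at h
      have hcube : Real.exp (2 / 3) ^ 3 = Real.exp 1 ^ 2 := by
        rw [← Real.exp_nat_mul, ← Real.exp_nat_mul]; norm_num
      have hp : (0 : ℝ) ≤ 1.95 := by norm_num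
      have h3 : (1.95 : ℝ) ^ 3 < Real.exp (2 / 3) ^ 3 := pow_lt_pow_left₀ h hp three_ne_zero
      rw [hcube] at h3
      have h4 : Real.exp 1 ^ 2 < 2.7182818286 ^ 2 :=
        pow_lt_pow_left₀ he2 (Real.exp_pos 1).le two_ne_zero
      norm_num at h3 h4
      linarith
    exact (Real.exp_le_exp.2 hγ2.le).trans h23

/-- **Line (f) at the true `e^γ`:** the envelope for `vGamma L = (3/2)·e^γ·log L`.
[cite: LamzouriLiSoundararajan2015, Theorem 1.5 p. 2393] -/
theorem vGamma_envelope {L : ℝ} (hL : 43250 ≤ L) :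
    1.7810725 * (Real.log L + Real.log (Real.log L)) < vGamma L ∧
      vGamma L < 2 * 1.7810724 * (Real.log L - Real.log 2 + 1 / 2 + 1 / Real.log L) ∧
        vGamma L ≤ Real.log (Real.exp L) :=
  envelope exp_eulerMascheroni_mem.1 exp_eulerMascheroni_mem.2 hL

end Literature.NumberTheory.LFunctions.Zhang2022.DHMenuLines

end
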